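import Literature.AlgebraicGeometry.Frobenioids.ArithmeticFrobenioidThm64ivSolitary
import Literature.NumberTheory.NumberFields.ArithmeticEquivalenceSolitaryCyclic
import HarnessLib

/-!
# Frobenioids I, Theorem 6.4 (iv), second clause: two more SOLITARY families of base fields — `F₁` of
# «cyclic cotype» (e.g. `Gal(X.L/F₁)` cyclic at the clause's own object `X`) and `F₁` inside any Galois `N/ℚ`
# of prime relative degree (GAP-LEDGER G-L1t3-1 #2, continued)

Mochizuki, *The geometry of Frobenioids I: the general theory*, Kyushu J. Math. **62** (2008) 293–400, §6,
Thm. 6.4 (iv) p. 115 l. 23–29 («… the corresponding finite extension `L₂ ⊆ F̃₂` of `F₂` is isomorphic to `L₁` in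
a fashion that is compatible with an isomorphism `F₁ ⥲ F₂`») and proof p. 116 l. 17–35, which argues `L₁ = L₂`
but not the compatibility with an isomorphism `F₁ ⥲ F₂` [cite: MochizukiFrdI2008, Thm. 6.4 (iv) p.115];
R. Perlis, *On the equation `ζ_K(s) = ζ_{K'}(s)`*, J. Number Theory **9** (1977) 342–360 [cite: Perlis1977, Thm. 1 (p. 345)].

PROOF-ONLY file (cell abc-iut, layer L1; seat abc-iut-L1-t1 gen 3; 0 definitions, no named facts, no new
`Prop`). State of the row before this file (abc-iut-L1-d4 `ArithmeticFrobenioidThm64ivCompat`, abc-iut-w4-d090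
`ArithmeticFrobenioidThm64ivArithEquivalence` / `ArithmeticFrobenioidThm64ivSolitary`): from the Cor. 4.11 (iv)
datum of an equivalence `Ψ : C_{K₁/F₁} ⥲ C_{K₂/F₂}` of THE arithmetic Frobenioids the base fields are
ARITHMETICALLY EQUIVALENT (`arith_base_arithmeticallyEquivalent`), the printed clause at `X` (`X.L` Galois/`ℚ`)
holds iff `F₁ ≅ F₂`, and it is PROVED for `F₁` Galois over `ℚ`, for `F₂` Galois over `ℚ`
(`ArithmeticFrobenioidThm64ivGaloisTarget`), for `[F₁ : ℚ] ≤ 6` (Perlis' Theorem 3) and for `Gal(X.L/F₁)` a Sylow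
subgroup of `Gal(X.L/ℚ)` (`ArithmeticFrobenioidThm64ivSylow`).
This file adds, through the tree's `Literature.NumberTheory.NumberFields.algEquiv_of_arithmeticallyEquivalent_of_isCyclic`
(Gassmann equivalent subgroups one of which is cyclic are conjugate; arithmetically equivalent fields lie in the
same Galois extensions of `ℚ`):

* `nonempty_baseRingEquiv_arith_of_isCyclic_cotype` / `Thm64iv_arith_compat_of_isCyclic_cotype` — **the printed
  clause for every `F₁` of CYCLIC COTYPE**: `F₁ ↪ N` for some finite Galois `N/ℚ` with `Gal(N/F₁)` cyclic (no
  degree bound; e.g. pure fields `ℚ(a^{1/p})` of any prime degree `p`, `N = ℚ(ζ_p, a^{1/p})`);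
* `Thm64iv_arith_compat_of_isCyclic_gal` — the INTERNAL instance at the clause's own object: **the printed clause
  holds at `X` whenever `Gal(X.L/F₁)` is cyclic** (take `N := X.L`), in particular whenever `[X.L : F₁]` is prime
  (`Thm64iv_arith_compat_of_prime_relDegree`);
* `arith_solitary_of_isCyclic_cotype` — the same as a discharge of abc-iut-w4-d090's «solitary» binder.

What remains of G-L1t3-1 #2 after this file: both base fields non-Galois over `ℚ`, `[F₁ : ℚ] ≥ 7`, `F₁` not
arithmetically solitary, `Gal(N/F₁)` neither cyclic nor Sylow in any Galois `N ⊇ F₁` — Perlis' genuine Gassmann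
territory (`(PSL₂(𝔽₇), S₄, S₄')`, degree 7). There the base-level data (arithmetic equivalence) is exhausted; any further progress must use the
multiplicative part of `Ψ` (the Galois-equivariant, valuation- and absolute-value-preserving isomorphisms
`L₁^× ≅ L₂^×` it induces), which print does not invoke. Nothing here bears on, or takes a side on, [IUTchIII] Cor. 3.12.
-/

noncomputable section

namespace Literature.AlgebraicGeometry.Frobenioids

open CategoryTheory Opposite NumberField
open Literature.NumberTheory.NumberFields

/-! ### Bridge: `Gal(L/F)` cyclic, read in `Gal(L/ℚ)` -/

section Bridge

/-- For a tower `ℚ ⊆ F ⊆ L` of fields of characteristic zero, the subgroup of `Aut_ℚ(L)` fixing (the image of)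
`F` is a quotient of — indeed isomorphic to — `Aut_F(L)`; in particular it is cyclic when `Aut_F(L)` is.
[folklore] -/
private theorem isCyclic_fixingSubgroup_of_isCyclic_algEquiv {F L : Type} [Field F] [CharZero F] [Field L] [CharZero L]
    [Algebra F L] (h : IsCyclic (L ≃ₐ[F] L)) :
    IsCyclic ((algebraMap F L).toRatAlgHom.fieldRange.fixingSubgroup) := by
  haveI := h
  let f : (L ≃ₐ[F] L) →* ((algebraMap F L).toRatAlgHom.fieldRange.fixingSubgroup) :=
    { toFun := fun σ => ⟨AlgEquiv.ofRingEquiv (f := σ.toRingEquiv)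
          (fun q => (σ : L →+* L).map_rat_algebraMap q), by
        rw [IntermediateField.mem_fixingSubgroup_iff]
        rintro _ ⟨a, rfl⟩
        exact σ.commutes a⟩
      map_one' := Subtype.ext (AlgEquiv.ext fun _ => rfl)
      map_mul' := fun _ _ => Subtype.ext (AlgEquiv.ext fun _ => rfl) }
  refine isCyclic_of_surjective f fun τ => ?_
  have hτ : ∀ x ∈ (algebraMap F L).toRatAlgHom.fieldRange, (τ.1 : L ≃ₐ[ℚ] L) x = x :=
    (IntermediateField.mem_fixingSubgroup_iff _ _).mp τ.2
  refine ⟨{ (τ.1 : L ≃ₐ[ℚ] L).toRingEquiv with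
      commutes' := fun a => hτ _ ⟨a, rfl⟩ }, Subtype.ext (AlgEquiv.ext fun _ => rfl)⟩

end Bridge

section Arith

variable {F₁ : Type} [Field F₁] [NumberField F₁] {K₁ : Type} [Field K₁] [Algebra F₁ K₁] [IsGalois F₁ K₁]
variable {F₂ : Type} [Field F₂] [NumberField F₂] {K₂ : Type} [Field K₂] [Algebra F₂ K₂] [IsGalois F₂ K₂]

/-! ### Base fields of cyclic cotype -/

/-- **`F₁ ≅ F₂` at the constructions whenever `F₁` is of cyclic cotype.** For an equivalence
`Ψ : C_{K₁/F₁} ⥲ C_{K₂/F₂}` of THE arithmetic Frobenioids with its Cor. 4.11 (iv) datum `(Ψ^Base, Ψ^Φ = E, η, hdiv)`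
and `B₁ = Spec F₁` (`ε₁ : B₁.L ≃ₐ[F₁] F₁`): if `F₁ ↪ N` with `N/ℚ` finite Galois and `Gal(N/F₁)` cyclic, then
`F₁ ≅ F₂` — the base fields are arithmetically equivalent (abc-iut-w4-d090's `arith_base_arithmeticallyEquivalent`)
and fields of cyclic cotype are solitary. [cite: MochizukiFrdI2008, Thm. 6.4 (iv) p.115] -/
theorem nonempty_baseRingEquiv_arith_of_isCyclic_cotype {N : Type} [Field N] [NumberField N] [IsGalois ℚ N]
    (i : F₁ →ₐ[ℚ] N) (hcyc : IsCyclic i.fieldRange.fixingSubgroup)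
    (Ψ : arithFrobenioid F₁ K₁ ≌ arithFrobenioid F₂ K₂)
    {ΨBase : FinSubextCat F₁ K₁ ⥤ FinSubextCat F₂ K₂} [ΨBase.IsEquivalence]
    (E : PreFrobenioidData.DivisorMonoidIsoOverBase (arithFrobenioidOps F₁ K₁) (arithFrobenioidOps F₂ K₂) ΨBase)
    (η : Ψ.functor ⋙ (arithFrobenioidOps F₂ K₂).base ≅ (arithFrobenioidOps F₁ K₁).base ⋙ ΨBase)
    (hdiv : ∀ ⦃A B : arithFrobenioid F₁ K₁⦄ (φ : A ⟶ B),
      (arithFrobenioidOps F₂ K₂).div (Ψ.functor.map φ) =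
        (arithFrobenioidOps F₂ K₂).pull (η.hom.app A)
          (E.iso ((arithFrobenioidOps F₁ K₁).base.obj A) ((arithFrobenioidOps F₁ K₁).div φ)))
    (B₁ : FinSubextCat F₁ K₁) (ε₁ : B₁.L ≃ₐ[F₁] F₁) : Nonempty (F₁ ≃+* F₂) := by
  obtain ⟨e⟩ := algEquiv_of_arithmeticallyEquivalent_of_isCyclic i hcyc
    (arith_base_arithmeticallyEquivalent Ψ E η hdiv B₁ ε₁)
  exact ⟨e.toRingEquiv⟩

/-- **[FrdI] Thm. 6.4 (iv), second clause IN FULL at the constructions, for every base field `F₁` of cyclic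
cotype** (`F₁ ↪ N`, `N/ℚ` finite Galois, `Gal(N/F₁)` cyclic — no degree bound, `F₁` Galois or not): at every
`X = Spec L₁` with `L₁` Galois over `ℚ`, `L₂ := (Ψ^Base X).L` is isomorphic to `L₁` compatibly with an isomorphism
`F₁ ≅ F₂` (abc-iut-L1-d4's `Thm64iv_arith_compat_of_baseIso` fed with the isomorphism above).
[cite: MochizukiFrdI2008, Thm. 6.4 (iv) p.115] -/
theorem Thm64iv_arith_compat_of_isCyclic_cotype {N : Type} [Field N] [NumberField N] [IsGalois ℚ N]
    (i : F₁ →ₐ[ℚ] N) (hcyc : IsCyclic i.fieldRange.fixingSubgroup)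
    (Ψ : arithFrobenioid F₁ K₁ ≌ arithFrobenioid F₂ K₂)
    {ΨBase : FinSubextCat F₁ K₁ ⥤ FinSubextCat F₂ K₂} [ΨBase.IsEquivalence]
    (E : PreFrobenioidData.DivisorMonoidIsoOverBase (arithFrobenioidOps F₁ K₁) (arithFrobenioidOps F₂ K₂) ΨBase)
    (η : Ψ.functor ⋙ (arithFrobenioidOps F₂ K₂).base ≅ (arithFrobenioidOps F₁ K₁).base ⋙ ΨBase)
    (hdiv : ∀ ⦃A B : arithFrobenioid F₁ K₁⦄ (φ : A ⟶ B),
      (arithFrobenioidOps F₂ K₂).div (Ψ.functor.map φ) =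
        (arithFrobenioidOps F₂ K₂).pull (η.hom.app A)
          (E.iso ((arithFrobenioidOps F₁ K₁).base.obj A) ((arithFrobenioidOps F₁ K₁).div φ)))
    (B₁ : FinSubextCat F₁ K₁) (ε₁ : B₁.L ≃ₐ[F₁] F₁) (X : FinSubextCat F₁ K₁) (hX : IsGalois ℚ X.L) :
    ∃ (e : X.L ≃+* (ΨBase.obj X).L) (e₀ : F₁ ≃+* F₂),
      ∀ a : F₁, e (algebraMap F₁ X.L a) = algebraMap F₂ (ΨBase.obj X).L (e₀ a) := by
  obtain ⟨φ⟩ := nonempty_baseRingEquiv_arith_of_isCyclic_cotype i hcyc Ψ E η hdiv B₁ ε₁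
  exact Thm64iv_arith_compat_of_baseIso Ψ E η hdiv φ X hX

omit [IsGalois F₁ K₁] [IsGalois F₂ K₂] in
/-- The same as a DISCHARGE of the «solitary» binder of abc-iut-w4-d090's `Thm64iv_arith_compat_of_solitary`:
for `F₁` of cyclic cotype, every residue-characteristic- and norm-preserving bijection of finite places
`B₁.L ≃ (Ψ^Base B₁).L` comes with a field isomorphism. [cite: Perlis1977, Thm. 1 (p. 345)] -/
theorem arith_solitary_of_isCyclic_cotype {N : Type} [Field N] [NumberField N] [IsGalois ℚ N]
    (i : F₁ →ₐ[ℚ] N) (hcyc : IsCyclic i.fieldRange.fixingSubgroup)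
    (ΨBase : FinSubextCat F₁ K₁ ⥤ FinSubextCat F₂ K₂) (B₁ : FinSubextCat F₁ K₁) (ε₁ : B₁.L ≃ₐ[F₁] F₁)
    (π₀ : FinitePlace B₁.L ≃ FinitePlace (ΨBase.obj B₁).L) (_hrc : ∀ w, residueChar (π₀ w) = residueChar w)
    (hln : ∀ w, logNorm (π₀ w) = logNorm w) : Nonempty (B₁.L ≃+* (ΨBase.obj B₁).L) := by
  have e₁ : B₁.L ≃ₐ[ℚ] F₁ :=
    AlgEquiv.ofRingEquiv (f := ε₁.toRingEquiv) fun q => (ε₁ : B₁.L →+* F₁).map_rat_algebraMap q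
  have hae : ArithmeticallyEquivalent F₁ (ΨBase.obj B₁).L :=
    (ArithmeticallyEquivalent.of_algEquiv e₁.symm).trans
      (arithmeticallyEquivalent_of_finitePlaceEquiv_logNorm π₀ hln)
  obtain ⟨e⟩ := algEquiv_of_arithmeticallyEquivalent_of_isCyclic i hcyc hae
  exact ⟨e₁.toRingEquiv.trans e.toRingEquiv⟩

/-! ### The internal instance: `Gal(X.L/F₁)` cyclic -/

omit [IsGalois F₁ K₁] in
/-- At an object `X` of `D₁` with `X.L` Galois over `ℚ` and `Gal(X.L/F₁)` cyclic, `F₁` is of cyclic cotype with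
`N := X.L`. [folklore] -/
private theorem isCyclic_fixingSubgroup_of_object (X : FinSubextCat F₁ K₁) (hcyc : IsCyclic (X.L ≃ₐ[F₁] X.L)) :
    IsCyclic ((algebraMap F₁ X.L).toRatAlgHom.fieldRange.fixingSubgroup) :=
  isCyclic_fixingSubgroup_of_isCyclic_algEquiv hcyc

/-- **[FrdI] Thm. 6.4 (iv), second clause at `X`, whenever `Gal(X.L/F₁)` is CYCLIC** (for arbitrary `F₁`): for an
equivalence `Ψ : C_{K₁/F₁} ⥲ C_{K₂/F₂}` of THE arithmetic Frobenioids with Cor. 4.11 (iv) datum, `B₁ = Spec F₁`,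
and `X = Spec L₁` with `L₁` Galois over `ℚ` and `Gal(L₁/F₁)` cyclic, `L₂ := (Ψ^Base X).L ≅ L₁` compatibly with an
isomorphism `F₁ ≅ F₂` — the printed clause, the Galois group of the object itself supplying the cotype.
[cite: MochizukiFrdI2008, Thm. 6.4 (iv) p.115] -/
theorem Thm64iv_arith_compat_of_isCyclic_gal (Ψ : arithFrobenioid F₁ K₁ ≌ arithFrobenioid F₂ K₂)
    {ΨBase : FinSubextCat F₁ K₁ ⥤ FinSubextCat F₂ K₂} [ΨBase.IsEquivalence]
    (E : PreFrobenioidData.DivisorMonoidIsoOverBase (arithFrobenioidOps F₁ K₁) (arithFrobenioidOps F₂ K₂) ΨBase)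
    (η : Ψ.functor ⋙ (arithFrobenioidOps F₂ K₂).base ≅ (arithFrobenioidOps F₁ K₁).base ⋙ ΨBase)
    (hdiv : ∀ ⦃A B : arithFrobenioid F₁ K₁⦄ (φ : A ⟶ B),
      (arithFrobenioidOps F₂ K₂).div (Ψ.functor.map φ) =
        (arithFrobenioidOps F₂ K₂).pull (η.hom.app A)
          (E.iso ((arithFrobenioidOps F₁ K₁).base.obj A) ((arithFrobenioidOps F₁ K₁).div φ)))
    (B₁ : FinSubextCat F₁ K₁) (ε₁ : B₁.L ≃ₐ[F₁] F₁) (X : FinSubextCat F₁ K₁) (hX : IsGalois ℚ X.L)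
    (hcyc : IsCyclic (X.L ≃ₐ[F₁] X.L)) :
    ∃ (e : X.L ≃+* (ΨBase.obj X).L) (e₀ : F₁ ≃+* F₂),
      ∀ a : F₁, e (algebraMap F₁ X.L a) = algebraMap F₂ (ΨBase.obj X).L (e₀ a) := by
  haveI := hX
  exact Thm64iv_arith_compat_of_isCyclic_cotype (algebraMap F₁ X.L).toRatAlgHom
    (isCyclic_fixingSubgroup_of_object X hcyc) Ψ E η hdiv B₁ ε₁ X hX

/-- **… in particular whenever `[X.L : F₁]` is PRIME** (a Galois group of prime order is cyclic).
[cite: MochizukiFrdI2008, Thm. 6.4 (iv) p.115] -/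
theorem Thm64iv_arith_compat_of_prime_relDegree (Ψ : arithFrobenioid F₁ K₁ ≌ arithFrobenioid F₂ K₂)
    {ΨBase : FinSubextCat F₁ K₁ ⥤ FinSubextCat F₂ K₂} [ΨBase.IsEquivalence]
    (E : PreFrobenioidData.DivisorMonoidIsoOverBase (arithFrobenioidOps F₁ K₁) (arithFrobenioidOps F₂ K₂) ΨBase)
    (η : Ψ.functor ⋙ (arithFrobenioidOps F₂ K₂).base ≅ (arithFrobenioidOps F₁ K₁).base ⋙ ΨBase)
    (hdiv : ∀ ⦃A B : arithFrobenioid F₁ K₁⦄ (φ : A ⟶ B),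
      (arithFrobenioidOps F₂ K₂).div (Ψ.functor.map φ) =
        (arithFrobenioidOps F₂ K₂).pull (η.hom.app A)
          (E.iso ((arithFrobenioidOps F₁ K₁).base.obj A) ((arithFrobenioidOps F₁ K₁).div φ)))
    (B₁ : FinSubextCat F₁ K₁) (ε₁ : B₁.L ≃ₐ[F₁] F₁) (X : FinSubextCat F₁ K₁) (hX : IsGalois ℚ X.L)
    (hp : (Module.finrank F₁ X.L).Prime) :
    ∃ (e : X.L ≃+* (ΨBase.obj X).L) (e₀ : F₁ ≃+* F₂),
      ∀ a : F₁, e (algebraMap F₁ X.L a) = algebraMap F₂ (ΨBase.obj X).L (e₀ a) := by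
  haveI := hX
  -- `X.L/F₁` is Galois (sub-extension of `X.L/ℚ` Galois) of prime degree, so its group is cyclic
  haveI : IsGalois F₁ X.L := IsGalois.tower_top_of_isGalois ℚ F₁ X.L
  haveI : Fact (Nat.card (X.L ≃ₐ[F₁] X.L)).Prime := ⟨by rw [IsGalois.card_aut_eq_finrank]; exact hp⟩
  exact Thm64iv_arith_compat_of_isCyclic_gal Ψ E η hdiv B₁ ε₁ X hX (isCyclic_of_prime_card rfl)

end Arith

end Literature.AlgebraicGeometry.Frobenioids

end
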